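import Literature.MathematicalPhysics.QuantumFieldTheory.Balaban1983to89.Beta.AveragedAFCarrier
import Summits.QuantumFields.BalabanUV.Gaps.CapFloorNotNecessary
import Summits.QuantumFields.BalabanUV.Gaps.CapSignsNecessaryFwd

/-!
# Gaps / CapAvgAFNecessary — [I] Theorem 2 AS PRINTED ⟹ the AVERAGED-AF CARRIER `BetaAvgAFH`: on the every-slope road, (N2)'s window floor of the
# one-loop coefficients plus the remainder's constant form IS the β sub-cell's slope-grade carrier (the input of node U2 and of the END statement's
# partial-sums road) — so (0.31), typed as a hypothesis, supplies that carrier; and the alternating family sits in the carrier yet below every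
# eventual pointwise floor (cell pub-balaban-gaps, seat g1-p3 gen 3, CAP+tail charge; §1–§2 and §4 ADOPT g1-plan-2 GEN 8's lens kernel X-46
# `g1/skeletons/XreadThm2FeedsU2_plan2.lean` 39f390bb6aa33805, on the planner's disposition; §3 = the junction over this seat's `_fwd` (N2))

HONEST FRAMING (cell rule, page 1 of everything): bookkeeping over the β sub-cell's hypothesis carriers; NOTHING of Bałaban's is asserted beyond
print; [Balaban1987RG1] Thm 2 is UNPROVED IN PRINT and is the HYPOTHESIS `B12.Thm2Printed C L`; `BetaAvgAFH` is a HYPOTHESIS SHAPE of the tree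
(`Beta.AveragedAFCarrier`), never asserted of (1.22); 0 binders discharged; NOT `BetaPertH`, NOT the continuum limit, NOT Clay.  Zero classification
weight (node U2 is downstream of the β sub-cell; plan-2 lens L-5).  HONEST DEPENDENCY (b2b cell, verbatim): «continuum YM on T⁴ ⇐ BetaPertH ∧ nine
spine estimates (0/9 proved); BetaPertH ⇐ (D1) ∧ (D4) ∧ CAP+tail; G-an2-4 gates asym, D1 and NE2/3/4.»

CONTENT.  §1 JUNCTION: (N2)'s output `c·n − A ≤ Σ_{[k,k+n)} β⁰` + a one-sided remainder floor `−r ≤ β¹` on `]0,γ]`-histories IS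
`BetaAvgAFH (c − r) A γ β` (`betaAvgAFH_of_beta0Window_remainderLower` ∕ `_remainderConst`); conversely the carrier + `RemainderConst S γ r` returns the
β⁰-window floor with slope `s − r` (`beta0Window_of_betaAvgAFH_remainderConst`).  §2 CHAIN: (N2) + every-slope ⟹ `∃ s > 0, D ≥ 0, γ ∈ ]0,γc],
BetaAvgAFH s D γ β`.  §3 **`exists_betaAvgAFH_of_thm2Printed`**: for every FORWARD-GENERATED construction (hgen only, `CapSignsNecessaryFwd`),
`B12.Thm2Printed C L` (`L > 1`) + `EverySlope S γc` ⟹ the carrier at a positive slope on a small box; `_datum` on `T4Continuum.FiniteEpsData`.  So once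
the β sub-cell's output is typed as (0.31) on the every-slope road, node U2's carrier binder is NOT an independent input.  §4 SEPARATION:
this seat's alternating family `CapFloorNotNecessary.altBeta` (which HAS (0.31), `modelOf_alt_thm2Printed`) lies in the carrier at slope 1 on every
box (`betaAvgAFH_alt`) yet below EVERY eventual pointwise floor `T4CouplingMatching.EventualLowerH b γ k₀` (`not_eventualLowerH_alt`): (0.31)-shaped
data reach U2 through `BetaAvgAFH`, not through an eventual pointwise floor.  All [folklore]; 0 sorry; 0 def; imports `Beta.AveragedAFCarrier` +
`Gaps.CapSignsNecessaryFwd`; restates nothing.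
-/

namespace Summit.QuantumFields.BalabanUV.Gaps.CapAvgAFNecessary

open Literature.MathematicalPhysics.QuantumFieldTheory.Balaban1983to89
open Literature.MathematicalPhysics.QuantumFieldTheory.Balaban1983to89.FlowStep
open Literature.MathematicalPhysics.QuantumFieldTheory.Balaban1983to89.FlowStepRuns
open Literature.MathematicalPhysics.QuantumFieldTheory.Balaban1983to89.DagBinding
open Literature.MathematicalPhysics.QuantumFieldTheory.Balaban1983to89.Beta.RemainderChain (RemainderConst)
open Literature.MathematicalPhysics.QuantumFieldTheory.Balaban1983to89.Beta.AveragedAFCarrier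
open Literature.MathematicalPhysics.QuantumFieldTheory.Balaban1983to89.T4CouplingMatching (EventualLowerH eventualLowerH_of_betaLowerH)
open Summit.QuantumFields.BalabanUV.Gaps.CapSignsConstRoad (EverySlope)
open Summit.QuantumFields.BalabanUV.Gaps.CapSignsNecessaryFwd
open Summit.QuantumFields.BalabanUV.Gaps.CapFloorNotNecessary (altBeta modelOf_alt_thm2Printed)

noncomputable section

variable {β : HBeta}

/-! ## §1 Junction: β⁰-window floor + remainder floor = the carrier (g1-plan-2 X-46 §1) -/

/-- **(N2)'s OUTPUT + a one-sided remainder floor IS the averaged-AF carrier.**  `c·n − A ≤ Σ_{[k,k+n)} β⁰` for all `k, n` and `−r ≤ β¹_{j+1}` on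
the `]0,γ]`-histories give `BetaAvgAFH (c − r) A γ β`. [folklore] -/
theorem betaAvgAFH_of_beta0Window_remainderLower (S : B12Beta.OneLoopSplit β) {c A r γ : ℝ}
    (hw : ∀ k n : ℕ, c * n - A ≤ ∑ j ∈ Finset.Ico k (k + n), S.β0 j)
    (hlow : ∀ k (p : Fin (k + 1) → ℝ), p ∈ B12Beta.HistBox γ k → -r ≤ S.β1 k p) :
    BetaAvgAFH (c - r) A γ β := by
  intro g hg k n hkn
  obtain ⟨d, rfl⟩ := Nat.exists_eq_add_of_le hkn
  have h0 := hw k d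
  have hsplit : ∑ j ∈ Finset.Ico k (k + d), β j (prefixOf g j) =
      ∑ j ∈ Finset.Ico k (k + d), S.β0 j + ∑ j ∈ Finset.Ico k (k + d), S.β1 j (prefixOf g j) := by
    rw [← Finset.sum_add_distrib]
    exact Finset.sum_congr rfl fun j _ => S.split j _
  have hstep : ∀ j ∈ Finset.Ico k (k + d), -r ≤ S.β1 j (prefixOf g j) := fun j _ => hlow j _ fun i => hg i
  have h1 := Finset.sum_le_sum hstep
  rw [Finset.sum_const, Nat.card_Ico, nsmul_eq_mul] at h1
  have e : (((k + d : ℕ) : ℝ) - k) = d := by push_cast; ring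
  have e2 : ((k + d - k : ℕ) : ℝ) = d := by rw [Nat.add_sub_cancel_left]
  rw [e]; rw [e2] at h1
  rw [hsplit]
  nlinarith [h0, h1]

/-- The same from the two-sided constant form `RemainderConst S γ r`. [folklore] -/
theorem betaAvgAFH_of_beta0Window_remainderConst (S : B12Beta.OneLoopSplit β) {c A r γ : ℝ}
    (hw : ∀ k n : ℕ, c * n - A ≤ ∑ j ∈ Finset.Ico k (k + n), S.β0 j) (hrem : RemainderConst S γ r) :
    BetaAvgAFH (c - r) A γ β :=
  betaAvgAFH_of_beta0Window_remainderLower S hw fun k p hp => (abs_le.mp (hrem k p hp)).1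

/-- **CONVERSE**: the carrier with slope `s`, defect `D` on `]0,γ]` (`γ > 0`) and `|β¹| ≤ r` there give the β⁰-window floor with slope `s − r`,
defect `D` (evaluate along the constant history `γ`).  So (N2)'s output and the carrier are ONE datum modulo the remainder constant. [folklore] -/
theorem beta0Window_of_betaAvgAFH_remainderConst (S : B12Beta.OneLoopSplit β) {s D r γ : ℝ} (hγ : 0 < γ)
    (h : BetaAvgAFH s D γ β) (hrem : RemainderConst S γ r) :
    ∀ k n : ℕ, (s - r) * n - D ≤ ∑ j ∈ Finset.Ico k (k + n), S.β0 j := by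
  intro k n
  have h1 := h (fun _ => γ) (fun _ => ⟨hγ, le_rfl⟩) k (k + n) (Nat.le_add_right k n)
  have hsplit : ∑ j ∈ Finset.Ico k (k + n), β j (prefixOf (fun _ => γ) j) =
      ∑ j ∈ Finset.Ico k (k + n), S.β0 j + ∑ j ∈ Finset.Ico k (k + n), S.β1 j (prefixOf (fun _ => γ) j) := by
    rw [← Finset.sum_add_distrib]
    exact Finset.sum_congr rfl fun j _ => S.split j _
  have hstep : ∀ j ∈ Finset.Ico k (k + n), S.β1 j (prefixOf (fun _ => γ) j) ≤ r :=
    fun j _ => (abs_le.mp (hrem j _ fun _ => ⟨hγ, le_rfl⟩)).2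
  have h2 := Finset.sum_le_sum hstep
  rw [Finset.sum_const, Nat.card_Ico, nsmul_eq_mul, Nat.add_sub_cancel_left] at h2
  have e : (((k + n : ℕ) : ℝ) - k) = n := by push_cast; ring
  rw [e, hsplit] at h1
  nlinarith [h1, h2]

/-! ## §2 Chain: (N2) + every-slope ⟹ the carrier at a positive slope on a small box (g1-plan-2 X-46 §2) -/

/-- (N2)'s window floor with slope `c > 0` + the every-slope currency ⟹ `BetaAvgAFH s D γ β` for some `s > 0`, `D ≥ 0`, `γ ∈ ]0,γc]`
(remainder box at `c/2`; the defect is nonnegative by `BetaAvgAFH.defect_nonneg`). [folklore] -/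
theorem exists_betaAvgAFH_of_beta0Window_everySlope (S : B12Beta.OneLoopSplit β) {γc : ℝ}
    (hN2 : ∃ c : ℝ, 0 < c ∧ ∃ A : ℝ, ∀ k n : ℕ, c * n - A ≤ ∑ j ∈ Finset.Ico k (k + n), S.β0 j)
    (hrem : EverySlope S γc) :
    ∃ s : ℝ, 0 < s ∧ ∃ D γ : ℝ, 0 ≤ D ∧ 0 < γ ∧ γ ≤ γc ∧ BetaAvgAFH s D γ β := by
  obtain ⟨c, hc, A, hw⟩ := hN2
  obtain ⟨γ, hγ, hγc, hR⟩ := hrem (c / 2) (by positivity)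
  have h : BetaAvgAFH (c - c / 2) A γ β := betaAvgAFH_of_beta0Window_remainderConst S hw hR
  exact ⟨c - c / 2, by linarith, A, γ, h.defect_nonneg hγ, hγ, hγc, h⟩

/-! ## §3 Theorem 2 as printed supplies the carrier -/

/-- **[I] THEOREM 2 AS PRINTED SUPPLIES THE AVERAGED-AF CARRIER** (every-slope road): for every FORWARD-GENERATED construction from a split with
`EverySlope S γc`, `B12.Thm2Printed C L` with `L > 1` gives `BetaAvgAFH s D γ β` for some `s > 0`, `D ≥ 0`, `γ ∈ ]0,γc]`
(`CapSignsNecessaryFwd.beta0_windowSum_lower_of_thm2Printed_fwd` + §2).  The carrier is the input of node U2 and of the END statement's partial-sums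
road; so once the β sub-cell's output is typed as (0.31) on this road, that binder is not an independent input. [cite: Balaban1987RG1, Thm 2 (0.31) p.259] -/
theorem exists_betaAvgAFH_of_thm2Printed {C : B12.Construction} (hgen : ForwardGenerated C β) (S : B12Beta.OneLoopSplit β)
    {γc : ℝ} (hrem : EverySlope S γc) {L : ℝ} (hL : 1 < L) (h : B12.Thm2Printed C L) :
    ∃ s : ℝ, 0 < s ∧ ∃ D γ : ℝ, 0 ≤ D ∧ 0 < γ ∧ γ ≤ γc ∧ BetaAvgAFH s D γ β :=
  exists_betaAvgAFH_of_beta0Window_everySlope S (beta0_windowSum_lower_of_thm2Printed_fwd hgen S hrem hL h) hrem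

/-- The same ON THE DATUM `D : T4Continuum.FiniteEpsData F G` (via `D.fwd`). [cite: Balaban1987RG1, Thm 2 (0.31) p.259] -/
theorem exists_betaAvgAFH_of_thm2Printed_datum {F : T4Continuum.T4Family} {G : Type*} [GaugeGroup G] [MeasurableSpace G]
    [HaarData G] (D : T4Continuum.FiniteEpsData F G) (S : B12Beta.OneLoopSplit D.βfun) {γc : ℝ} (hrem : EverySlope S γc)
    {L : ℝ} (hL : 1 < L) (h : B12.Thm2Printed D.C.toB12 L) :
    ∃ s : ℝ, 0 < s ∧ ∃ D' γ : ℝ, 0 ≤ D' ∧ 0 < γ ∧ γ ≤ γc ∧ BetaAvgAFH s D' γ D.βfun :=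
  exists_betaAvgAFH_of_thm2Printed D.fwd S hrem hL h

/-! ## §4 Separation: the alternating family is in the carrier, below every eventual pointwise floor (g1-plan-2 X-46 §3) -/

/-- Along any positive history this seat's alternating family `CapFloorNotNecessary.altBeta` (`β_{k+1} = g_k` at even `k`, `2` at odd `k`)
dominates `1 − (−1)^j` termwise. [folklore] -/
theorem altBeta_ge (j : ℕ) (p : Fin (j + 1) → ℝ) (hp : 0 < p (Fin.last j)) : 1 - (-1 : ℝ) ^ j ≤ altBeta j p := by
  unfold altBeta
  rcases Nat.even_or_odd j with hj | hj
  · rw [if_pos (Nat.even_iff.mp hj), hj.neg_one_pow]; linarith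
  · rw [if_neg (by rw [Nat.odd_iff.mp hj]; omega), hj.neg_one_pow]; norm_num

/-- **THE ALTERNATING FAMILY IS IN THE CARRIER**: `BetaAvgAFH 1 1 γ altBeta` for every `γ` (window sums `≥ (n − k) − 1`). [folklore] -/
theorem betaAvgAFH_alt (γ : ℝ) : BetaAvgAFH 1 1 γ altBeta := by
  intro g hg k n hkn
  have hstep : ∀ j ∈ Finset.Ico k n, 1 - (-1 : ℝ) ^ j ≤ altBeta j (prefixOf g j) :=
    fun j _ => altBeta_ge j _ (by simpa [prefixOf_apply] using (hg j).1)
  have hsum := Finset.sum_le_sum hstep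
  rw [Finset.sum_sub_distrib, Finset.sum_const, Nat.card_Ico, nsmul_eq_mul, Nat.cast_sub hkn, mul_one] at hsum
  have hosc := (abs_le.mp (Osc.abs_sum_negOnePow_le k n hkn)).2
  linarith

/-- **… BUT BELOW EVERY EVENTUAL POINTWISE FLOOR**: for every `b > 0`, `γ > 0`, `k₀`, `¬ EventualLowerH b γ k₀ altBeta` (at the even scale `2k₀` the
value is the last coupling, which may be `min γ (b/2) < b`). [folklore] -/
theorem not_eventualLowerH_alt {b γ : ℝ} (hb : 0 < b) (hγ : 0 < γ) (k₀ : ℕ) : ¬ EventualLowerH b γ k₀ altBeta := by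
  intro h
  have hv : (fun _ : Fin (2 * k₀ + 1) => min γ (b / 2)) ∈ Box γ (2 * k₀) :=
    mem_box.mpr fun _ => ⟨lt_min hγ (by positivity), min_le_left _ _⟩
  have h1 := h (2 * k₀) _ (by omega) hv
  have h2 : altBeta (2 * k₀) (fun _ : Fin (2 * k₀ + 1) => min γ (b / 2)) = min γ (b / 2) := by
    simp [altBeta]
  rw [h2] at h1
  have := min_le_right γ (b / 2)
  linarith

/-- Nor the all-`k` pointwise floor `BetaLowerH b γ` for any `b > 0`. [folklore] -/
theorem not_betaLowerH_alt {b γ : ℝ} (hb : 0 < b) (hγ : 0 < γ) : ¬ BetaLowerH b γ altBeta := fun h =>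
  not_eventualLowerH_alt hb hγ 0 (eventualLowerH_of_betaLowerH h 0)

/-- **SEPARATION, packaged**: a history family in the averaged-AF carrier at slope 1 on every box, below every eventual pointwise floor, whose
canonical forward-generated construction satisfies [I] Theorem 2 AS PRINTED for every `L > 1` (`CapFloorNotNecessary.modelOf_alt_thm2Printed`).
(0.31)-shaped data reach node U2 through `BetaAvgAFH`, not through `EventualLowerH`. [folklore] -/
theorem carrier_thm2_not_eventualFloor :
    ∃ β : HBeta, (∀ γ : ℝ, BetaAvgAFH 1 1 γ β) ∧ (∀ L : ℝ, 1 < L → B12.Thm2Printed (modelOf β) L) ∧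
      ∀ b γ : ℝ, 0 < b → 0 < γ → ∀ k₀ : ℕ, ¬ EventualLowerH b γ k₀ β :=
  ⟨altBeta, betaAvgAFH_alt, fun _ hL => modelOf_alt_thm2Printed hL, fun _ _ hb hγ k₀ => not_eventualLowerH_alt hb hγ k₀⟩

end

end Summit.QuantumFields.BalabanUV.Gaps.CapAvgAFNecessary
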